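import Summits.ResolutionOfSingularities.ResolutionOfSingularities.Theorems.DeltaCutSepCertificates3
import HarnessLib

/-!
# DeltaCutSepCertificates4 — decomp-res node «SepCut» (lens-6 g26, critic row 196 CLEARED +1), tree file 7/8 of the node

Content VERBATIM from the decomp-res lens-6 g26 node `HOME/decomp-res-lens-6/g26/SepCut.lean` (pin f15f025c; no
carry, imports the landed tree only); HOME = run/shared/lean/pub/decomp-res; critic row 196 CLEARED +1; landing plan
NEXT-g27.md fb3fac1c §4 + rider INBOX :1178 — provenance, critic text and the lens header in full in the first file
of the node, `DeltaCutSep`.  Namespace `…Theorems.DeltaCutClasses`; `--supports stmt-ResolutionOfSingularities-26971`.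

## This file

Continuation 4/5 of `DeltaCutSepCertificates` (same section of the node, cut at the 400-line cap): carries
`BS_L1_plane`, `BS_L1_chart_z_noTop`, `BS_L2_planeCharts`, `BS_L2_planeChart_t_noTop`, `BS_L2_planeChart_z_noTop`,
`BS_sepHeightTwo_certificate`, `Cx_top`, `Cx_axes`.

[WRITER NOTE (decomp-res writer g12): file split only (tree files ≤ 400 lines); namespace, sections, section opens
and every declaration exactly as in the lens (the node's HOME-only dupNamespace-linter line is dropped; the two
namespace-level `open …TwistCutClasses` / `open …LightCutClasses` lines of the node are replayed); in the
CERTIFICATES files the lens's five `private` helpers (`mem_of_sMul_mem_cube`, `mul_mem_pow_add`,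
`not_mem_span_of_eval`, `sMul_not_mem_sq_of_pderiv_eq_one`, and `one_not_mem_prime`) lose `private` because their
users now sit in later parts of the split, and `one_not_mem_prime` — statement-identical to the LANDED
`one_not_mem_of_isPrime` of g25 `DeltaCutRunCertificates` (a `dedup.landed` restatement) — is DELETED and its 12
uses cite `one_not_mem_of_isPrime` (hence the extra import `DeltaCutRunCertificates`); likewise `mul_mem_pow_add` —
statement-identical to the LANDED `Rescue.BedZpeBinom4Centre.mul_mem_pow_add` of another hand (cone-free module;
pre-flight `dedup.landed`) — is DELETED, that module imported and `open … (mul_mem_pow_add)` replayed in each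
certificates file so the 6 uses stand verbatim.]

(Sources: Hironaka1967 (characteristic polyhedra); CossartJannsenSaito2020 Def. 3.13 / Thm. 3.14, Ch. 8, Thm. 9.6;
Hironaka1970 (near points / vertices); CossartPiltant2019 Prop. 2.6; CossartPiltant2008 §2; Giraud1975; Hironaka2005
(three key theorems: order under permissible blow-up); EGAIV4 §16–§17; StacksProject 0804 / 0BIQ / 031I; Matsumura1987 §28.)
-/

noncomputable section

open CategoryTheory CategoryTheory.Limits AlgebraicGeometry TopologicalSpace IsLocalRing
open Literature.AlgebraicGeometry.Resolution

universe u

open Summit.ResolutionOfSingularities.ResolutionOfSingularities.Theorems.Rescue.BedZpeBinom4Centre (mul_mem_pow_add)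

namespace Summit.ResolutionOfSingularities.ResolutionOfSingularities.Theorems.DeltaCutClasses

open Summit.ResolutionOfSingularities.ResolutionOfSingularities.Theorems.TwistCutClasses
open Summit.ResolutionOfSingularities.ResolutionOfSingularities.Theorems.LightCutClasses

section SepCertificates

open MvPolynomial
variable {K : Type*} [Field K]

/-- **B_S, LEVEL 1, chart `t` — the PLANE `P = (z', t)` lies in the top locus** (`f₁ ∈ P³`), is a PLANE (`u', w' ∉ P`), is WILD
everywhere (`f₁ = z'³ + r`, `r = t⁴h ∈ P⁴`) and has a NEAR POINT over EVERY closed point `c` (parameters `z', t, π = u' − a,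
w' − b` at `c`; chart `π` of the blow-up at `c`: `z''³ + π·t''⁴·H ∈ 𝔫''³` for EVERY cofactor `H`): bad₁ ∩ chart `t` = all closed
points of the plane, whose closure is the plane `= T₁` (projective, regular: dictionary (R)). [new; elementary] [folklore] -/
theorem BS_L1_plane :
    (X 0 ^ 3 + X 1 ^ 4 * (1 + X 2 ^ 7 + X 3 ^ 7) : MvPolynomial (Fin 4) K) ∈ (Ideal.span {(X 0 : MvPolynomial (Fin 4) K), X 1}) ^ 3 ∧
      ((X 2 : MvPolynomial (Fin 4) K) ∉ Ideal.span {(X 0 : MvPolynomial (Fin 4) K), X 1} ∧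
        (X 3 : MvPolynomial (Fin 4) K) ∉ Ideal.span {(X 0 : MvPolynomial (Fin 4) K), X 1}) ∧
      (X 1 ^ 4 * (1 + X 2 ^ 7 + X 3 ^ 7) : MvPolynomial (Fin 4) K) ∈ (Ideal.span {(X 0 : MvPolynomial (Fin 4) K), X 1}) ^ 4 ∧
      ∀ H : MvPolynomial (Fin 4) K, (X 0 ^ 3 + X 2 * (X 1 ^ 4 * H) : MvPolynomial (Fin 4) K) ∈
        (Ideal.span {(X 0 : MvPolynomial (Fin 4) K), X 1, X 2, X 3}) ^ 3 := by
  have hX0 : (X 0 : MvPolynomial (Fin 4) K) ∈ Ideal.span {(X 0 : MvPolynomial (Fin 4) K), X 1} := Ideal.subset_span (by simp)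
  have hX1 : (X 1 : MvPolynomial (Fin 4) K) ∈ Ideal.span {(X 0 : MvPolynomial (Fin 4) K), X 1} := Ideal.subset_span (by simp)
  have hr : (X 1 ^ 4 * (1 + X 2 ^ 7 + X 3 ^ 7) : MvPolynomial (Fin 4) K) ∈ (Ideal.span {(X 0 : MvPolynomial (Fin 4) K), X 1}) ^ 4 :=
    Ideal.mul_mem_right _ _ (Ideal.pow_mem_pow hX1 4)
  refine ⟨Ideal.add_mem _ (Ideal.pow_mem_pow hX0 3) (Ideal.pow_le_pow_right (by norm_num) hr), ⟨?_, ?_⟩, hr, fun H => ?_⟩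
  · refine not_mem_span_of_eval _ (fun i => if i = 2 then 1 else 0) ?_ (by simp)
    intro g hg
    simp only [Set.mem_insert_iff, Set.mem_singleton_iff] at hg
    rcases hg with rfl | rfl <;> simp
  · refine not_mem_span_of_eval _ (fun i => if i = 3 then 1 else 0) ?_ (by simp)
    intro g hg
    simp only [Set.mem_insert_iff, Set.mem_singleton_iff] at hg
    rcases hg with rfl | rfl <;> simp
  · refine Ideal.add_mem _ (Ideal.pow_mem_pow (X_mem_spanX4 0) 3) ?_
    have h5 : (X 2 * X 1 ^ 4 : MvPolynomial (Fin 4) K) ∈ (Ideal.span {(X 0 : MvPolynomial (Fin 4) K), X 1, X 2, X 3}) ^ (1 + 4) :=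
      mul_mem_pow_add (by rw [pow_one]; exact X_mem_spanX4 2) (Ideal.pow_mem_pow (X_mem_spanX4 1) 4)
    have := Ideal.mul_mem_right H _ (Ideal.pow_le_pow_right (show 3 ≤ 1 + 4 by norm_num) h5)
    rwa [show (X 2 * X 1 ^ 4 * H : MvPolynomial (Fin 4) K) = X 2 * (X 1 ^ 4 * H) by ring] at this

/-- **B_S, LEVEL 1, chart `z` — NO top point**: `1 + z⁴·(t'⁷ + u'⁷ + w'⁷)` has no prime of order `≥ 3` (`∂_z` gives `z³·Σ ∈ 𝔮`,
then `1 ∈ 𝔮`). [new; elementary] [folklore] -/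
theorem BS_L1_chart_z_noTop [CharP K 3] (𝔮 : Ideal (MvPolynomial (Fin 4) K)) [𝔮.IsPrime] {s : MvPolynomial (Fin 4) K}
    (hs : s ∉ 𝔮) (h : s * (1 + X 0 ^ 4 * (X 1 ^ 7 + X 2 ^ 7 + X 3 ^ 7) : MvPolynomial (Fin 4) K) ∈ 𝔮 ^ 3) : False := by
  have hs2 : s ^ 2 ∉ 𝔮 := pow_not_mem 𝔮 hs 2
  have h4 : (4 : MvPolynomial (Fin 4) K) ∉ 𝔮 := by
    have := natCast_not_mem (K := K) 𝔮 (m := 4) (by decide)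
    exact_mod_cast this
  have e01 := f_ne K (i := 0) (j := 1) (by decide)
  have e02 := f_ne K (i := 0) (j := 2) (by decide)
  have e03 := f_ne K (i := 0) (j := 3) (by decide)
  have e00 := f_self K 0
  have d0 : pderiv 0 (1 + X 0 ^ 4 * (X 1 ^ 7 + X 2 ^ 7 + X 3 ^ 7) : MvPolynomial (Fin 4) K) =
      4 * (X 0 ^ 3 * (X 1 ^ 7 + X 2 ^ 7 + X 3 ^ 7)) ^ 1 := by
    simp only [map_add, Derivation.leibniz, Derivation.leibniz_pow, smul_eq_mul, nsmul_eq_mul, e00, e01, e02, e03, f_one]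
    push_cast; ring
  have h0 := sq_mul_deriv_mem_pow 𝔮 h (pderiv 0)
  rw [d0] at h0
  have hm : (X 0 ^ 3 * (X 1 ^ 7 + X 2 ^ 7 + X 3 ^ 7) : MvPolynomial (Fin 4) K) ∈ 𝔮 :=
    mem_of_mul_mul_pow_mem_pow 𝔮 two_ne_zero hs2 h4 h0
  have hf : (1 + X 0 ^ 4 * (X 1 ^ 7 + X 2 ^ 7 + X 3 ^ 7) : MvPolynomial (Fin 4) K) ∈ 𝔮 := mem_of_sMul_mem_cube 𝔮 hs h
  have : (1 : MvPolynomial (Fin 4) K) ∈ 𝔮 := by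
    have := Ideal.sub_mem _ hf (Ideal.mul_mem_left _ (X 0) hm)
    rwa [show (1 + X 0 ^ 4 * (X 1 ^ 7 + X 2 ^ 7 + X 3 ^ 7) - X 0 * (X 0 ^ 3 * (X 1 ^ 7 + X 2 ^ 7 + X 3 ^ 7)) :
      MvPolynomial (Fin 4) K) = 1 by ring] at this
  exact one_not_mem_of_isPrime 𝔮 this

/-- **B_S, STEP 1 OF LEVEL 1 = blow-up of the PLANE `V(z', t)`** (chart-`t` coordinates), chart `t`: `f₁(z''t, t, u', w') =
t³·(z''³ + t·h)`; chart `z'`: `f₁ = z'³·(1 + z'·t'⁴·h)`. [new; elementary] [folklore] -/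
theorem BS_L2_planeCharts :
    aeval (linChartSubst (K := K) {0, 1} 1) (X 0 ^ 3 + X 1 ^ 4 * (1 + X 2 ^ 7 + X 3 ^ 7) : MvPolynomial (Fin 4) K) =
        X 1 ^ 3 * (X 0 ^ 3 + X 1 * (1 + X 2 ^ 7 + X 3 ^ 7)) ∧
      aeval (linChartSubst (K := K) {0, 1} 0) (X 0 ^ 3 + X 1 ^ 4 * (1 + X 2 ^ 7 + X 3 ^ 7) : MvPolynomial (Fin 4) K) =
        X 0 ^ 3 * (1 + X 0 * X 1 ^ 4 * (1 + X 2 ^ 7 + X 3 ^ 7)) := by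
  refine ⟨?_, ?_⟩
  · simp [linChartSubst]; ring
  · simp [linChartSubst]; ring

/-- **B_S, LEVEL 2, plane-chart `t` — NO top point**: `z''³ + t·h` has no prime of order `≥ 3` (`∂_t` gives `h` of order `≥ 2`;
`∂_{u'}`, `∂_{w'}` of that: `u', w' ∈ 𝔮`; and `h ∈ 𝔮`: `1 ∈ 𝔮`). [new; elementary] [folklore] -/
theorem BS_L2_planeChart_t_noTop [CharP K 3] (𝔮 : Ideal (MvPolynomial (Fin 4) K)) [𝔮.IsPrime] {s : MvPolynomial (Fin 4) K}
    (hs : s ∉ 𝔮) (h : s * (X 0 ^ 3 + X 1 * (1 + X 2 ^ 7 + X 3 ^ 7) : MvPolynomial (Fin 4) K) ∈ 𝔮 ^ 3) : False := by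
  have hs2 : s ^ 2 ∉ 𝔮 := pow_not_mem 𝔮 hs 2
  have hs4 : (s ^ 2) ^ 2 ∉ 𝔮 := pow_not_mem 𝔮 hs2 2
  have h7 : (7 : MvPolynomial (Fin 4) K) ∉ 𝔮 := by
    have := natCast_not_mem (K := K) 𝔮 (m := 7) (by decide)
    exact_mod_cast this
  have e10 := f_ne K (i := 1) (j := 0) (by decide)
  have e12 := f_ne K (i := 1) (j := 2) (by decide)
  have e13 := f_ne K (i := 1) (j := 3) (by decide)
  have e23 := f_ne K (i := 2) (j := 3) (by decide)
  have e32 := f_ne K (i := 3) (j := 2) (by decide)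
  have e11 := f_self K 1
  have e22 := f_self K 2
  have e33 := f_self K 3
  have d1 : pderiv 1 (X 0 ^ 3 + X 1 * (1 + X 2 ^ 7 + X 3 ^ 7) : MvPolynomial (Fin 4) K) = 1 + X 2 ^ 7 + X 3 ^ 7 := by
    simp only [map_add, Derivation.leibniz, Derivation.leibniz_pow, smul_eq_mul, nsmul_eq_mul, e10, e11, e12, e13, f_one]
    push_cast; ring
  have d12 : pderiv 2 (1 + X 2 ^ 7 + X 3 ^ 7 : MvPolynomial (Fin 4) K) = 7 * X 2 ^ 6 := by
    simp only [map_add, Derivation.leibniz_pow, smul_eq_mul, nsmul_eq_mul, e22, e23, f_one]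
    push_cast; ring
  have d13 : pderiv 3 (1 + X 2 ^ 7 + X 3 ^ 7 : MvPolynomial (Fin 4) K) = 7 * X 3 ^ 6 := by
    simp only [map_add, Derivation.leibniz_pow, smul_eq_mul, nsmul_eq_mul, e32, e33, f_one]
    push_cast; ring
  have h1 := sq_mul_deriv_mem_pow 𝔮 h (pderiv 1)
  rw [d1] at h1
  have hX2 : (X 2 : MvPolynomial (Fin 4) K) ∈ 𝔮 := by
    have h' := sq_mul_deriv_mem_pow 𝔮 h1 (pderiv 2)
    rw [d12] at h'
    exact mem_of_mul_mul_pow_mem_pow 𝔮 one_ne_zero hs4 h7 h'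
  have hX3 : (X 3 : MvPolynomial (Fin 4) K) ∈ 𝔮 := by
    have h' := sq_mul_deriv_mem_pow 𝔮 h1 (pderiv 3)
    rw [d13] at h'
    exact mem_of_mul_mul_pow_mem_pow 𝔮 one_ne_zero hs4 h7 h'
  have hh : (1 + X 2 ^ 7 + X 3 ^ 7 : MvPolynomial (Fin 4) K) ∈ 𝔮 :=
    (‹𝔮.IsPrime›.mem_or_mem (Ideal.pow_le_self two_ne_zero h1)).resolve_left hs2
  have : (1 : MvPolynomial (Fin 4) K) ∈ 𝔮 := by
    have := Ideal.sub_mem _ (Ideal.sub_mem _ hh (Ideal.pow_mem_of_mem 𝔮 hX2 7 (by norm_num)))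
      (Ideal.pow_mem_of_mem 𝔮 hX3 7 (by norm_num))
    rwa [show (1 + X 2 ^ 7 + X 3 ^ 7 - X 2 ^ 7 - X 3 ^ 7 : MvPolynomial (Fin 4) K) = 1 by ring] at this
  exact one_not_mem_of_isPrime 𝔮 this

/-- **B_S, LEVEL 2, plane-chart `z'` — NO top point**: `1 + z'·t'⁴·h` has no prime of order `≥ 3` (`∂_{z'}` gives
`t'⁴h ∈ 𝔮`, then
`1 ∈ 𝔮`). [new; elementary] [folklore] -/
theorem BS_L2_planeChart_z_noTop (𝔮 : Ideal (MvPolynomial (Fin 4) K)) [𝔮.IsPrime] {s : MvPolynomial (Fin 4) K} (hs : s ∉ 𝔮)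
    (h : s * (1 + X 0 * X 1 ^ 4 * (1 + X 2 ^ 7 + X 3 ^ 7) : MvPolynomial (Fin 4) K) ∈ 𝔮 ^ 3) : False := by
  have hs2 : s ^ 2 ∉ 𝔮 := pow_not_mem 𝔮 hs 2
  have e01 := f_ne K (i := 0) (j := 1) (by decide)
  have e02 := f_ne K (i := 0) (j := 2) (by decide)
  have e03 := f_ne K (i := 0) (j := 3) (by decide)
  have e00 := f_self K 0
  have d0 : pderiv 0 (1 + X 0 * X 1 ^ 4 * (1 + X 2 ^ 7 + X 3 ^ 7) : MvPolynomial (Fin 4) K) =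
      X 1 ^ 4 * (1 + X 2 ^ 7 + X 3 ^ 7) := by
    simp only [map_add, Derivation.leibniz, Derivation.leibniz_pow, smul_eq_mul, nsmul_eq_mul, e00, e01, e02, e03, f_one]
    push_cast; ring
  have h0 := sq_mul_deriv_mem_pow 𝔮 h (pderiv 0)
  rw [d0] at h0
  have hm : (X 1 ^ 4 * (1 + X 2 ^ 7 + X 3 ^ 7) : MvPolynomial (Fin 4) K) ∈ 𝔮 :=
    (‹𝔮.IsPrime›.mem_or_mem (Ideal.pow_le_self two_ne_zero h0)).resolve_left hs2
  have hf : (1 + X 0 * X 1 ^ 4 * (1 + X 2 ^ 7 + X 3 ^ 7) : MvPolynomial (Fin 4) K) ∈ 𝔮 := mem_of_sMul_mem_cube 𝔮 hs h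
  have : (1 : MvPolynomial (Fin 4) K) ∈ 𝔮 := by
    have := Ideal.sub_mem _ hf (Ideal.mul_mem_left _ (X 0) hm)
    rwa [show (1 + X 0 * X 1 ^ 4 * (1 + X 2 ^ 7 + X 3 ^ 7) - X 0 * (X 1 ^ 4 * (1 + X 2 ^ 7 + X 3 ^ 7)) :
      MvPolynomial (Fin 4) K) = 1 by ring] at this
  exact one_not_mem_of_isPrime 𝔮 this

/-- **B_S — THE SEPARATING CERTIFICATE (g25 kind A at level 1; g26-DECIDED at sep-height 2).**  LEVEL 0: top locus = {origin}
(g24 `BS_isolated`), bad₀ = {origin} (wild + near point, g24 `BS_chain_certificate`): ACTIVE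
(`sepActive_of_badFinite`), step 2 empty,
so sep-level 1 = the point blow-up; LEVEL 1 (charts `t`, `u`, `w` by symmetry, `z`): in chart `t` the top locus is
the exceptional
PLANE `V(z', t)` (`BS_L1_chart_t_top`), wild everywhere with near points everywhere (`BS_L1_plane`), chart `z` has no top point
(`BS_L1_chart_z_noTop`) — so `closure bad₁ = T₁` = the exceptional projective plane `{z' = 0} ⊆ E ≅ ℙ³`, REGULAR
(dictionary (R)):
ACTIVE; step 2 empty (`T₁ ∖ closure bad₁ = ∅`); LEVEL 2 = the blow-up of the plane (dictionary (L); chart-`t` coordinates, the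
other affine pieces by the `S₃`-symmetry `BS_charts`): plane-chart `t`: NO top point (`BS_L2_planeChart_t_noTop`),
plane-chart `z'`:
NO top point (`BS_L2_planeChart_z_noTop`): sep-level 2 has EMPTY support — `SepTerminates` at height 2, B_S ∈
`WORTopRunHeavySepTame 3`'s data. [new] [folklore] -/
theorem BS_sepHeightTwo_certificate [CharP K 3] :
    -- level 0 (tree): isolated top point
    (∀ (𝔮 : Ideal (MvPolynomial (Fin 4) K)) [𝔮.IsPrime], ∀ s ∉ 𝔮,
        s * (X 0 ^ 3 + X 1 ^ 7 + X 2 ^ 7 + X 3 ^ 7 : MvPolynomial (Fin 4) K) ∈ 𝔮 ^ 3 →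
          (X 0 : MvPolynomial (Fin 4) K) ∈ 𝔮 ∧ (X 1 : MvPolynomial (Fin 4) K) ∈ 𝔮 ∧
            (X 2 : MvPolynomial (Fin 4) K) ∈ 𝔮 ∧ (X 3 : MvPolynomial (Fin 4) K) ∈ 𝔮) ∧
    -- level 1: charts, top = the plane in chart t, wild + near everywhere, chart z empty
      (aeval (chartSubst (K := K) 1) (X 0 ^ 3 + X 1 ^ 7 + X 2 ^ 7 + X 3 ^ 7 : MvPolynomial (Fin 4) K) =
          X 1 ^ 3 * (X 0 ^ 3 + X 1 ^ 4 * (1 + X 2 ^ 7 + X 3 ^ 7)) ∧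
        aeval (chartSubst (K := K) 0) (X 0 ^ 3 + X 1 ^ 7 + X 2 ^ 7 + X 3 ^ 7 : MvPolynomial (Fin 4) K) =
          X 0 ^ 3 * (1 + X 0 ^ 4 * (X 1 ^ 7 + X 2 ^ 7 + X 3 ^ 7)) ∧
        rename (Equiv.swap (1 : Fin 4) 2) (X 0 ^ 3 + X 1 ^ 7 + X 2 ^ 7 + X 3 ^ 7 : MvPolynomial (Fin 4) K) =
          X 0 ^ 3 + X 1 ^ 7 + X 2 ^ 7 + X 3 ^ 7 ∧
        rename (Equiv.swap (1 : Fin 4) 3) (X 0 ^ 3 + X 1 ^ 7 + X 2 ^ 7 + X 3 ^ 7 : MvPolynomial (Fin 4) K) =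
          X 0 ^ 3 + X 1 ^ 7 + X 2 ^ 7 + X 3 ^ 7) ∧
      (∀ (𝔮 : Ideal (MvPolynomial (Fin 4) K)) [𝔮.IsPrime], ∀ s ∉ 𝔮,
        s * (X 0 ^ 3 + X 1 ^ 4 * (1 + X 2 ^ 7 + X 3 ^ 7) : MvPolynomial (Fin 4) K) ∈ 𝔮 ^ 3 →
          (X 0 : MvPolynomial (Fin 4) K) ∈ 𝔮 ∧ (X 1 : MvPolynomial (Fin 4) K) ∈ 𝔮) ∧
      ((X 0 ^ 3 + X 1 ^ 4 * (1 + X 2 ^ 7 + X 3 ^ 7) : MvPolynomial (Fin 4) K) ∈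
          (Ideal.span {(X 0 : MvPolynomial (Fin 4) K), X 1}) ^ 3 ∧
        ((X 2 : MvPolynomial (Fin 4) K) ∉ Ideal.span {(X 0 : MvPolynomial (Fin 4) K), X 1} ∧
          (X 3 : MvPolynomial (Fin 4) K) ∉ Ideal.span {(X 0 : MvPolynomial (Fin 4) K), X 1}) ∧
        (X 1 ^ 4 * (1 + X 2 ^ 7 + X 3 ^ 7) : MvPolynomial (Fin 4) K) ∈ (Ideal.span {(X 0 : MvPolynomial (Fin 4) K), X 1}) ^ 4 ∧
        ∀ H : MvPolynomial (Fin 4) K, (X 0 ^ 3 + X 2 * (X 1 ^ 4 * H) : MvPolynomial (Fin 4) K) ∈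
          (Ideal.span {(X 0 : MvPolynomial (Fin 4) K), X 1, X 2, X 3}) ^ 3) ∧
      (∀ (𝔮 : Ideal (MvPolynomial (Fin 4) K)) [𝔮.IsPrime], ∀ s ∉ 𝔮,
        s * (1 + X 0 ^ 4 * (X 1 ^ 7 + X 2 ^ 7 + X 3 ^ 7) : MvPolynomial (Fin 4) K) ∈ 𝔮 ^ 3 → False) ∧
    -- level 2: the plane blow-up, both charts empty
      (aeval (linChartSubst (K := K) {0, 1} 1) (X 0 ^ 3 + X 1 ^ 4 * (1 + X 2 ^ 7 + X 3 ^ 7) : MvPolynomial (Fin 4) K) =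
          X 1 ^ 3 * (X 0 ^ 3 + X 1 * (1 + X 2 ^ 7 + X 3 ^ 7)) ∧
        aeval (linChartSubst (K := K) {0, 1} 0) (X 0 ^ 3 + X 1 ^ 4 * (1 + X 2 ^ 7 + X 3 ^ 7) : MvPolynomial (Fin 4) K) =
          X 0 ^ 3 * (1 + X 0 * X 1 ^ 4 * (1 + X 2 ^ 7 + X 3 ^ 7))) ∧
      (∀ (𝔮 : Ideal (MvPolynomial (Fin 4) K)) [𝔮.IsPrime], ∀ s ∉ 𝔮,
        s * (X 0 ^ 3 + X 1 * (1 + X 2 ^ 7 + X 3 ^ 7) : MvPolynomial (Fin 4) K) ∈ 𝔮 ^ 3 → False) ∧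
      (∀ (𝔮 : Ideal (MvPolynomial (Fin 4) K)) [𝔮.IsPrime], ∀ s ∉ 𝔮,
        s * (1 + X 0 * X 1 ^ 4 * (1 + X 2 ^ 7 + X 3 ^ 7) : MvPolynomial (Fin 4) K) ∈ 𝔮 ^ 3 → False) :=
  ⟨fun 𝔮 _ _ hs h => BS_isolated 𝔮 hs h, BS_charts, fun 𝔮 _ _ hs h => BS_L1_chart_t_top 𝔮 hs h, BS_L1_plane,
    fun 𝔮 _ _ hs h => BS_L1_chart_z_noTop 𝔮 hs h, BS_L2_planeCharts, fun 𝔮 _ _ hs h => BS_L2_planeChart_t_noTop 𝔮 hs h,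
    fun 𝔮 _ _ hs h => BS_L2_planeChart_z_noTop 𝔮 hs h⟩

/-! #### C× = `z³ + t⁴ + u⁴·w⁴` — the `SepFrozen` inhabitant -/

/-- **C× — THE TOP LOCUS is the union of the `u`-axis and the `w`-axis**: a prime of order `≥ 3` contains `z`, `t`,
and `u` or `w`
(`∂_t f = 4t³`; `∂_u f = 4u³w⁴`; `z³`). [new; elementary] [folklore] -/
theorem Cx_top [CharP K 3] (𝔮 : Ideal (MvPolynomial (Fin 4) K)) [𝔮.IsPrime] {s : MvPolynomial (Fin 4) K} (hs : s ∉ 𝔮)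
    (h : s * (X 0 ^ 3 + X 1 ^ 4 + X 2 ^ 4 * X 3 ^ 4 : MvPolynomial (Fin 4) K) ∈ 𝔮 ^ 3) :
    (X 0 : MvPolynomial (Fin 4) K) ∈ 𝔮 ∧ (X 1 : MvPolynomial (Fin 4) K) ∈ 𝔮 ∧
      ((X 2 : MvPolynomial (Fin 4) K) ∈ 𝔮 ∨ (X 3 : MvPolynomial (Fin 4) K) ∈ 𝔮) := by
  have hs2 : s ^ 2 ∉ 𝔮 := pow_not_mem 𝔮 hs 2
  have h4 : (4 : MvPolynomial (Fin 4) K) ∉ 𝔮 := by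
    have := natCast_not_mem (K := K) 𝔮 (m := 4) (by decide)
    exact_mod_cast this
  have e10 := f_ne K (i := 1) (j := 0) (by decide)
  have e12 := f_ne K (i := 1) (j := 2) (by decide)
  have e13 := f_ne K (i := 1) (j := 3) (by decide)
  have e20 := f_ne K (i := 2) (j := 0) (by decide)
  have e21 := f_ne K (i := 2) (j := 1) (by decide)
  have e23 := f_ne K (i := 2) (j := 3) (by decide)
  have e11 := f_self K 1
  have e22 := f_self K 2
  have d1 : pderiv 1 (X 0 ^ 3 + X 1 ^ 4 + X 2 ^ 4 * X 3 ^ 4 : MvPolynomial (Fin 4) K) = 4 * X 1 ^ 3 := by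
    simp only [map_add, Derivation.leibniz, Derivation.leibniz_pow, smul_eq_mul, nsmul_eq_mul, e10, e11, e12, e13]
    push_cast; ring
  have d2 : pderiv 2 (X 0 ^ 3 + X 1 ^ 4 + X 2 ^ 4 * X 3 ^ 4 : MvPolynomial (Fin 4) K) = 4 * (X 2 ^ 3 * X 3 ^ 4) ^ 1 := by
    simp only [map_add, Derivation.leibniz, Derivation.leibniz_pow, smul_eq_mul, nsmul_eq_mul, e20, e21, e22, e23]
    push_cast; ring
  have hX1 : (X 1 : MvPolynomial (Fin 4) K) ∈ 𝔮 := by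
    have h1 := sq_mul_deriv_mem_pow 𝔮 h (pderiv 1)
    rw [d1] at h1
    exact mem_of_mul_mul_pow_mem_pow 𝔮 two_ne_zero hs2 h4 h1
  have hX23 : (X 2 : MvPolynomial (Fin 4) K) ∈ 𝔮 ∨ (X 3 : MvPolynomial (Fin 4) K) ∈ 𝔮 := by
    have h2 := sq_mul_deriv_mem_pow 𝔮 h (pderiv 2)
    rw [d2] at h2
    have h23 : (X 2 ^ 3 * X 3 ^ 4 : MvPolynomial (Fin 4) K) ∈ 𝔮 := mem_of_mul_mul_pow_mem_pow 𝔮 two_ne_zero hs2 h4 h2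
    rcases ‹𝔮.IsPrime›.mem_or_mem h23 with h' | h'
    · exact Or.inl (‹𝔮.IsPrime›.mem_of_pow_mem 3 h')
    · exact Or.inr (‹𝔮.IsPrime›.mem_of_pow_mem 4 h')
  have hf : (X 0 ^ 3 + X 1 ^ 4 + X 2 ^ 4 * X 3 ^ 4 : MvPolynomial (Fin 4) K) ∈ 𝔮 := mem_of_sMul_mem_cube 𝔮 hs h
  have h2344 : (X 2 ^ 4 * X 3 ^ 4 : MvPolynomial (Fin 4) K) ∈ 𝔮 := by
    rcases hX23 with h' | h'
    · exact Ideal.mul_mem_right _ _ (Ideal.pow_mem_of_mem 𝔮 h' 4 (by norm_num))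
    · exact Ideal.mul_mem_left _ _ (Ideal.pow_mem_of_mem 𝔮 h' 4 (by norm_num))
  have hX0 : (X 0 : MvPolynomial (Fin 4) K) ∈ 𝔮 := by
    refine ‹𝔮.IsPrime›.mem_of_pow_mem 3 ?_
    have := Ideal.sub_mem _ (Ideal.sub_mem _ hf (Ideal.pow_mem_of_mem 𝔮 hX1 4 (by norm_num))) h2344
    rwa [show (X 0 ^ 3 + X 1 ^ 4 + X 2 ^ 4 * X 3 ^ 4 - X 1 ^ 4 - X 2 ^ 4 * X 3 ^ 4 : MvPolynomial (Fin 4) K) = X 0 ^ 3 by ring]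
      at this
  exact ⟨hX0, hX1, hX23⟩

/-- **C× — BOTH AXES lie in the top locus, are LINES, and are WILD δ-HEAVY EVERYWHERE**: `f ∈ P_u³`, `f ∈ P_w³` for
`P_u = (z, t, w)`,
`P_w = (z, t, u)` (`u ∉ P_u`, `w ∉ P_w`); `f = z³ + r` with `r = t⁴ + u⁴w⁴ ∈ P_u⁴ ∩ P_w⁴` (the `3`-power form at
EVERY point of either
axis: WILD); and over every closed point `c` of the `u`-axis (parameters `z, t, π = u − a, w`; chart `π`: `f =
π³(z'³ + π(t'⁴ + H·w'⁴))`,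
`H = (a + π)⁴`) the chart origin is a NEAR POINT: `z'³ + π(t'⁴ + H w'⁴) ∈ 𝔫'³` for EVERY `H`; symmetrically on the `w`-axis.  So
bad₀ = ALL closed points of `V(z, t, u·w)` — INFINITE (kind A at level 0 for g25) and NONEMPTY. [new; elementary] [folklore] -/
theorem Cx_axes :
    ((X 0 ^ 3 + X 1 ^ 4 + X 2 ^ 4 * X 3 ^ 4 : MvPolynomial (Fin 4) K) ∈ (Ideal.span {(X 0 : MvPolynomial (Fin 4) K), X 1, X 3}) ^ 3 ∧
      (X 0 ^ 3 + X 1 ^ 4 + X 2 ^ 4 * X 3 ^ 4 : MvPolynomial (Fin 4) K) ∈ (Ideal.span {(X 0 : MvPolynomial (Fin 4) K), X 1, X 2}) ^ 3) ∧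
      ((X 2 : MvPolynomial (Fin 4) K) ∉ Ideal.span {(X 0 : MvPolynomial (Fin 4) K), X 1, X 3} ∧
        (X 3 : MvPolynomial (Fin 4) K) ∉ Ideal.span {(X 0 : MvPolynomial (Fin 4) K), X 1, X 2}) ∧
      ((X 1 ^ 4 + X 2 ^ 4 * X 3 ^ 4 : MvPolynomial (Fin 4) K) ∈ (Ideal.span {(X 0 : MvPolynomial (Fin 4) K), X 1, X 3}) ^ 4 ∧
        (X 1 ^ 4 + X 2 ^ 4 * X 3 ^ 4 : MvPolynomial (Fin 4) K) ∈ (Ideal.span {(X 0 : MvPolynomial (Fin 4) K), X 1, X 2}) ^ 4) ∧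
      ((∀ H : MvPolynomial (Fin 4) K, (X 0 ^ 3 + X 2 * (X 1 ^ 4 + H * X 3 ^ 4) : MvPolynomial (Fin 4) K) ∈
          (Ideal.span {(X 0 : MvPolynomial (Fin 4) K), X 1, X 2, X 3}) ^ 3) ∧
        ∀ H : MvPolynomial (Fin 4) K, (X 0 ^ 3 + X 3 * (X 1 ^ 4 + H * X 2 ^ 4) : MvPolynomial (Fin 4) K) ∈
          (Ideal.span {(X 0 : MvPolynomial (Fin 4) K), X 1, X 2, X 3}) ^ 3) := by
  have hu0 : (X 0 : MvPolynomial (Fin 4) K) ∈ Ideal.span {(X 0 : MvPolynomial (Fin 4) K), X 1, X 3} := Ideal.subset_span (by simp)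
  have hu1 : (X 1 : MvPolynomial (Fin 4) K) ∈ Ideal.span {(X 0 : MvPolynomial (Fin 4) K), X 1, X 3} := Ideal.subset_span (by simp)
  have hu3 : (X 3 : MvPolynomial (Fin 4) K) ∈ Ideal.span {(X 0 : MvPolynomial (Fin 4) K), X 1, X 3} := Ideal.subset_span (by simp)
  have hw0 : (X 0 : MvPolynomial (Fin 4) K) ∈ Ideal.span {(X 0 : MvPolynomial (Fin 4) K), X 1, X 2} := Ideal.subset_span (by simp)
  have hw1 : (X 1 : MvPolynomial (Fin 4) K) ∈ Ideal.span {(X 0 : MvPolynomial (Fin 4) K), X 1, X 2} := Ideal.subset_span (by simp)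
  have hw2 : (X 2 : MvPolynomial (Fin 4) K) ∈ Ideal.span {(X 0 : MvPolynomial (Fin 4) K), X 1, X 2} := Ideal.subset_span (by simp)
  have hru : (X 1 ^ 4 + X 2 ^ 4 * X 3 ^ 4 : MvPolynomial (Fin 4) K) ∈ (Ideal.span {(X 0 : MvPolynomial (Fin 4) K), X 1, X 3}) ^ 4 :=
    Ideal.add_mem _ (Ideal.pow_mem_pow hu1 4) (Ideal.mul_mem_left _ _ (Ideal.pow_mem_pow hu3 4))
  have hrw : (X 1 ^ 4 + X 2 ^ 4 * X 3 ^ 4 : MvPolynomial (Fin 4) K) ∈ (Ideal.span {(X 0 : MvPolynomial (Fin 4) K), X 1, X 2}) ^ 4 :=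
    Ideal.add_mem _ (Ideal.pow_mem_pow hw1 4) (Ideal.mul_mem_right _ _ (Ideal.pow_mem_pow hw2 4))
  have hnear : ∀ (i j : Fin 4) (H : MvPolynomial (Fin 4) K), (X 0 ^ 3 + X i * (X 1 ^ 4 + H * X j ^ 4) : MvPolynomial (Fin 4) K) ∈
      (Ideal.span {(X 0 : MvPolynomial (Fin 4) K), X 1, X 2, X 3}) ^ 3 := fun i j H => by
    refine Ideal.add_mem _ (Ideal.pow_mem_pow (X_mem_spanX4 0) 3) ?_
    have h14 : (X 1 ^ 4 + H * X j ^ 4 : MvPolynomial (Fin 4) K) ∈ (Ideal.span {(X 0 : MvPolynomial (Fin 4) K), X 1, X 2, X 3}) ^ 4 :=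
      Ideal.add_mem _ (Ideal.pow_mem_pow (X_mem_spanX4 1) 4) (Ideal.mul_mem_left _ _ (Ideal.pow_mem_pow (X_mem_spanX4 j) 4))
    exact Ideal.mul_mem_left _ _ (Ideal.pow_le_pow_right (by norm_num) h14)
  refine ⟨⟨?_, ?_⟩, ⟨?_, ?_⟩, ⟨hru, hrw⟩, fun H => hnear 2 3 H, fun H => hnear 3 2 H⟩
  · rw [add_assoc]; exact Ideal.add_mem _ (Ideal.pow_mem_pow hu0 3) (Ideal.pow_le_pow_right (by norm_num) hru)
  · rw [add_assoc]; exact Ideal.add_mem _ (Ideal.pow_mem_pow hw0 3) (Ideal.pow_le_pow_right (by norm_num) hrw)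
  · refine not_mem_span_of_eval _ (fun i => if i = 2 then 1 else 0) ?_ (by simp)
    intro g hg
    simp only [Set.mem_insert_iff, Set.mem_singleton_iff] at hg
    rcases hg with rfl | rfl | rfl <;> simp
  · refine not_mem_span_of_eval _ (fun i => if i = 3 then 1 else 0) ?_ (by simp)
    intro g hg
    simp only [Set.mem_insert_iff, Set.mem_singleton_iff] at hg
    rcases hg with rfl | rfl | rfl <;> simp

end SepCertificates

end Summit.ResolutionOfSingularities.ResolutionOfSingularities.Theorems.DeltaCutClasses
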